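import Mathlib
import HarnessLib
import Summits.CriticalPhenomena.Ising3DConformalLimit.Theses.WeylWindow
import Literature.Probability.LatticeModels.CriticalUrsellFourFloor

/-!
# Birth skeleton — crux `EnergyShadowSummable` (route `WeylWindow`, item `stmt-CriticalPhenomena-4736`)

Line `birth` = the route's own two-layer plan for the rank-2 crux K
("EnergyShadowSummable ⇐ η > 0 → LebowitzEnergyBound → EnergyShadowSummable", route header
TWO-LAYER PLAN), cut so that the single OPEN input is isolated as a named stub that is strictly
WEAKER than `AnomalousForcesInteraction.EtaPositive` and exactly what K consumes:

* `stub_lebowitzSandwich` — for `x ∉ {0, e₁, -e₁}` (the coincidence set of `(0, e₁, x, x+e₁)`):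
  `0 ≤ ⟨ε₀;ε_x⟩_{β_c} ≤ G(x)² + G(x+e₁)·G(x-e₁)`, `G = criticalTwoPoint 3`, `ε_x = σ_xσ_{x+e₁}`.
  Floor = GKS II at distinct points (tree: `criticalCorr_two_mul_two_le_four`); ceiling = Lebowitz
  `U₄ ≤ 0` (tree: `criticalUrsellFour_nonpos`) + translation invariance (`criticalCorr_two_pair`).
  Provable now from `Literature.Probability.LatticeModels.CriticalUrsellFourFloor` (size M).
  [Lebowitz1974, eq. (2.5b); FriedliVelenik2017, Thm. 3.20]
* `stub_weightedBubbleFinite` — `Σ_{x ∈ ℤ³} ‖x‖⁻¹ · G(x)² < ∞` (the `‖x‖⁻¹`-weighted bubble):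
  "η > 0 in averaged form". OPEN — the hard stub. Rigorously `G ≤ C‖x‖⁻¹` (infrared bound,
  `criticalTwoPoint_bounds_holds`) gives only the log-divergent majorant `Σ ‖x‖⁻³`; it follows
  from `EtaPositive` (`G ≤ C‖x‖^{-(1+κ)}`, route AnomalousForcesInteraction) by the lattice
  p-series `summable_norm_rpow_neg` with `s = 3 + 2κ`. [FrohlichSimonSpencer1976; DuminilCopinICM2022 §8.4]

Composition: `energyShadow_summable_of` (hypothesis form, sorry-free: sandwich + AM–GM
`G(x+e₁)G(x-e₁) ≤ G(x+e₁)² + G(x-e₁)²` + the shift comparison `‖x‖⁻¹ ≤ 2‖x ± e₁‖⁻¹` off the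
coincidence set + `Summable.of_norm_bounded_eventually`), and `EnergyShadowSummable_of`, which
concludes the crux BY NAME from the two stubs.
-/

namespace Summit.CriticalPhenomena.Ising3DConformalLimit.Cruxes.EnergyShadowSummable.Birth

open Filter Literature.Probability.LatticeModels

/-! ### Stubs (the registered open sub-goals of the line) -/

/-- **Stub 1 (Lebowitz–Griffiths sandwich for the energy–energy truncation; provable now, M).**
Off the coincidence set `{0, e₁, -e₁}`:
`0 ≤ ⟨σ₀σ_{e₁}σ_xσ_{x+e₁}⟩ − ⟨σ₀σ_{e₁}⟩⟨σ_xσ_{x+e₁}⟩ ≤ G(x)² + G(x+e₁)G(x−e₁)`.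
Floor: `criticalCorr_two_mul_two_le_four` (GKS II, injective quadruple). Ceiling:
`criticalUrsellFour_nonpos` at `y = ![0, e₁, x, x+e₁]` and `criticalCorr_two_pair`
(`⟨σ_aσ_b⟩ = G(b − a)`). [Lebowitz1974 (2.5b); FriedliVelenik2017 Thm. 3.20] -/
theorem stub_lebowitzSandwich :
    ∀ x : Literature.Probability.LatticeModels.Site 3, x ≠ 0 → x ≠ Pi.single 0 1 →
      x ≠ -Pi.single 0 1 →
      0 ≤ Literature.Probability.LatticeModels.criticalCorr 3 4 ![0, Pi.single 0 1, x, x + Pi.single 0 1]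
            - Literature.Probability.LatticeModels.criticalCorr 3 2 ![0, Pi.single 0 1]
              * Literature.Probability.LatticeModels.criticalCorr 3 2 ![x, x + Pi.single 0 1] ∧
        Literature.Probability.LatticeModels.criticalCorr 3 4 ![0, Pi.single 0 1, x, x + Pi.single 0 1]
            - Literature.Probability.LatticeModels.criticalCorr 3 2 ![0, Pi.single 0 1]
              * Literature.Probability.LatticeModels.criticalCorr 3 2 ![x, x + Pi.single 0 1]
          ≤ Literature.Probability.LatticeModels.criticalTwoPoint 3 x ^ 2
            + Literature.Probability.LatticeModels.criticalTwoPoint 3 (x + Pi.single 0 1)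
              * Literature.Probability.LatticeModels.criticalTwoPoint 3 (x - Pi.single 0 1) := by
  sorry

/-- **Stub 2 (the `‖x‖⁻¹`-weighted bubble is finite — "η > 0 averaged"; OPEN, the hard stub).**
`Σ_{x ∈ ℤ³} ‖x‖_∞⁻¹ · ⟨σ₀σ_x⟩²_{β_c} < ∞` (the `x = 0` term is `0` since `‖0‖⁻¹ = 0`).
Known: only the borderline `Σ ‖x‖⁻³ = ∞` majorant from the infrared bound; implied by
`EtaPositive` via `summable_norm_rpow_neg`. [FrohlichSimonSpencer1976; DuminilCopinICM2022 §8.4] -/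
theorem stub_weightedBubbleFinite :
    Summable (fun x : Literature.Probability.LatticeModels.Site 3 =>
      (‖x‖ : ℝ)⁻¹ * Literature.Probability.LatticeModels.criticalTwoPoint 3 x ^ 2) := by
  sorry

/-! ### Composition (real proofs, no sorry below this line) -/

/-- A non-zero point of `ℤ³` has sup norm `≥ 1`. [folklore] -/
theorem one_le_norm_of_ne_zero {x : Site 3} (hx : x ≠ 0) : (1 : ℝ) ≤ ‖x‖ := by
  obtain ⟨i, hi⟩ := Function.ne_iff.1 hx
  calc (1 : ℝ) ≤ ‖x i‖ := by
        rw [Int.norm_eq_abs]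
        exact_mod_cast Int.one_le_abs hi
    _ ≤ ‖x‖ := norm_le_pi_norm x i

/-- Shift comparison of the weights off the coincidence set: if `‖a‖ = 1`, `x ≠ 0` and
`x + a ≠ 0` then `‖x‖⁻¹ ≤ 2‖x + a‖⁻¹` (since `‖x + a‖ ≤ ‖x‖ + 1 ≤ 2‖x‖`). [folklore] -/
theorem inv_norm_le_two_mul_inv_norm_add {a x : Site 3} (ha : ‖a‖ = 1) (hx : x ≠ 0)
    (hxa : x + a ≠ 0) : (‖x‖ : ℝ)⁻¹ ≤ 2 * ‖x + a‖⁻¹ := by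
  have h1 : (1 : ℝ) ≤ ‖x‖ := one_le_norm_of_ne_zero hx
  have h2 : (0 : ℝ) < ‖x + a‖ := norm_pos_iff.2 hxa
  have h3 : ‖x + a‖ ≤ 2 * ‖x‖ := (norm_add_le x a).trans (by rw [ha]; linarith)
  rw [show (2 : ℝ) * ‖x + a‖⁻¹ = (‖x + a‖ / 2)⁻¹ by rw [inv_div]; ring]
  exact inv_anti₀ (by positivity) (by linarith)

/-- **Composition, hypothesis form (sorry-free).** The sandwich and the weighted bubble give the
crux body: `Σ_x ‖x‖⁻¹ |⟨ε₀;ε_x⟩| < ∞`. Proof: off `{0, e₁, -e₁}`,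
`‖x‖⁻¹|⟨ε₀;ε_x⟩| ≤ ‖x‖⁻¹(G(x)² + G(x+e₁)² + G(x−e₁)²) ≤ ‖x‖⁻¹G(x)² + 2‖x+e₁‖⁻¹G(x+e₁)² + 2‖x−e₁‖⁻¹G(x−e₁)²`,
a summable majorant (two re-indexings of the weighted bubble); conclude by
`Summable.of_norm_bounded_eventually`. [folklore] -/
theorem energyShadow_summable_of
    (hS : ∀ x : Site 3, x ≠ 0 → x ≠ Pi.single 0 1 → x ≠ -Pi.single 0 1 →
      0 ≤ criticalCorr 3 4 ![0, Pi.single 0 1, x, x + Pi.single 0 1]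
            - criticalCorr 3 2 ![0, Pi.single 0 1] * criticalCorr 3 2 ![x, x + Pi.single 0 1] ∧
        criticalCorr 3 4 ![0, Pi.single 0 1, x, x + Pi.single 0 1]
            - criticalCorr 3 2 ![0, Pi.single 0 1] * criticalCorr 3 2 ![x, x + Pi.single 0 1]
          ≤ criticalTwoPoint 3 x ^ 2
            + criticalTwoPoint 3 (x + Pi.single 0 1) * criticalTwoPoint 3 (x - Pi.single 0 1))
    (hB : Summable (fun x : Site 3 => (‖x‖ : ℝ)⁻¹ * criticalTwoPoint 3 x ^ 2)) :
    Summable (fun x : Site 3 => (‖x‖ : ℝ)⁻¹ *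
      |criticalCorr 3 4 ![0, Pi.single 0 1, x, x + Pi.single 0 1]
        - criticalCorr 3 2 ![0, Pi.single 0 1] * criticalCorr 3 2 ![x, x + Pi.single 0 1]|) := by
  set e : Site 3 := Pi.single 0 1 with he
  set G : Site 3 → ℝ := criticalTwoPoint 3 with hG
  have he1 : ‖e‖ = 1 := by simp [he, Pi.norm_single]
  have hne1 : ‖-e‖ = 1 := by rw [norm_neg, he1]
  -- the summable majorant
  set g : Site 3 → ℝ := fun x =>
    (‖x‖ : ℝ)⁻¹ * G x ^ 2 + 2 * ((‖x + e‖ : ℝ)⁻¹ * G (x + e) ^ 2)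
      + 2 * ((‖x - e‖ : ℝ)⁻¹ * G (x - e) ^ 2) with hg
  have hBp : Summable (fun x : Site 3 => (‖x + e‖ : ℝ)⁻¹ * G (x + e) ^ 2) :=
    hB.comp_injective (add_left_injective e)
  have hBm : Summable (fun x : Site 3 => (‖x - e‖ : ℝ)⁻¹ * G (x - e) ^ 2) :=
    hB.comp_injective (sub_left_injective (b := e))
  have hgs : Summable g := (hB.add (hBp.mul_left 2)).add (hBm.mul_left 2)
  -- off the coincidence set
  have hcof : ∀ᶠ x : Site 3 in cofinite, x ∉ ({0, e, -e} : Set (Site 3)) :=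
    (Set.toFinite ({0, e, -e} : Set (Site 3))).eventually_cofinite_notMem
  refine Summable.of_norm_bounded_eventually hgs (hcof.mono fun x hx => ?_)
  simp only [Set.mem_insert_iff, Set.mem_singleton_iff, not_or] at hx
  obtain ⟨hx0, hxe, hxne⟩ := hx
  obtain ⟨hlo, hhi⟩ := hS x hx0 hxe hxne
  have hinv : (0 : ℝ) ≤ ‖x‖⁻¹ := inv_nonneg.2 (norm_nonneg _)
  -- shift comparisons
  have hpe : x + e ≠ 0 := fun h => hxne (eq_neg_of_add_eq_zero_left h)
  have hme : x + -e ≠ 0 := fun h => hxe (by rwa [← sub_eq_add_neg, sub_eq_zero] at h)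
  have hw1 : (‖x‖ : ℝ)⁻¹ ≤ 2 * ‖x + e‖⁻¹ := inv_norm_le_two_mul_inv_norm_add he1 hx0 hpe
  have hw2 : (‖x‖ : ℝ)⁻¹ ≤ 2 * ‖x - e‖⁻¹ := by
    rw [sub_eq_add_neg]; exact inv_norm_le_two_mul_inv_norm_add hne1 hx0 hme
  -- pointwise bound
  rw [Real.norm_of_nonneg (mul_nonneg hinv (abs_nonneg _)), abs_of_nonneg hlo]
  have hprod : G (x + e) * G (x - e) ≤ G (x + e) ^ 2 + G (x - e) ^ 2 := by
    nlinarith [sq_nonneg (G (x + e) - G (x - e)), sq_nonneg (G (x + e)), sq_nonneg (G (x - e))]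
  calc (‖x‖ : ℝ)⁻¹ * (criticalCorr 3 4 ![0, e, x, x + e] - criticalCorr 3 2 ![0, e] * criticalCorr 3 2 ![x, x + e])
      ≤ (‖x‖ : ℝ)⁻¹ * (G x ^ 2 + (G (x + e) ^ 2 + G (x - e) ^ 2)) := by
        refine mul_le_mul_of_nonneg_left (hhi.trans ?_) hinv
        linarith
    _ = (‖x‖ : ℝ)⁻¹ * G x ^ 2 + (‖x‖ : ℝ)⁻¹ * G (x + e) ^ 2 + (‖x‖ : ℝ)⁻¹ * G (x - e) ^ 2 := by ring
    _ ≤ (‖x‖ : ℝ)⁻¹ * G x ^ 2 + 2 * ‖x + e‖⁻¹ * G (x + e) ^ 2 + 2 * ‖x - e‖⁻¹ * G (x - e) ^ 2 := by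
        gcongr
    _ = g x := by simp only [hg]; ring

/-- **The skeleton theorem: the two stubs give the crux `EnergyShadowSummable` BY NAME.** -/
theorem EnergyShadowSummable_of :
    Summit.CriticalPhenomena.Ising3DConformalLimit.Theses.WeylWindow.EnergyShadowSummable :=
  energyShadow_summable_of stub_lebowitzSandwich stub_weightedBubbleFinite

end Summit.CriticalPhenomena.Ising3DConformalLimit.Cruxes.EnergyShadowSummable.Birth
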